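import Summits.Schanuel.Schanuel.Theorems.RootDecomp1KHyper59

/-!
# RootDecomp1KHyper — lens 6, generation 17 «BILOG STAIRCASE CELL» (BilogStair.lean edition 2 f0528a77…, 2567 l) — continuation (RootDecomp1KHyper60): §H Case II machinery (section `CaseII`: the twisted polynomial, the eliminant `resII`, its length and degree)

(lens-6 g17 `BilogStair.lean` edition 2, sha256 f0528a77…5850, own farm rc 0 · 0 sorry · axioms std; critic ACK STATUS L1737 PORT GO LOW (registered, no credit);
port by census-1 gen 15 in ten parts `RootDecomp1KHyper53`–`62` — see the PORT NOTE of part 53; `--supports stmt-Schanuel-33363`; rung 0.)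
-/

open Complex Polynomial IntermediateField Filter
open scoped BigOperators

namespace Summit.Schanuel.Schanuel.Theorems.RootDecomp1KHyper

namespace HyperCell

namespace LatCell

namespace Bilog

variable {n : ℕ}
open Summit.Schanuel.Schanuel.Theorems.RootDecomp1KRelLiouvilleCell (mvPolyMeasure_one_of_polyMeasure)

/-! ## §H  Case II machinery: the twisted polynomial `Φ̃`, the eliminant `Res_{x₂}(Φ̃, G) ∈ ℤ[x₁]`, its length,
degree and product formula at `π` -/

section CaseII

variable (Φ : MvPolynomial (Fin 2) ℤ)

/-- The twisted polynomial `Φ̃_{A,B,E}(x₁,x₂) := Σ_e Φ_e(x₁)·(E x₂ − A x₁)^e·B^{EΦ−e}` (`Φ = Σ_e Φ_e(x₁) x₂^e`,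
`EΦ = deg_{x₂} Φ`): it vanishes at `(π, (Aπ + Bρ)/E)` for every root `ρ` of `Φ(π, ·)`. -/
noncomputable def twist (A B : ℤ) (E : ℕ) : MvPolynomial (Fin 2) ℤ :=
  ∑ e ∈ Finset.range ((toPoly Φ).natDegree + 1),
    MvPolynomial.rename (Fin.castSucc : Fin 1 → Fin 2) ((toPoly Φ).coeff e) *
      (MvPolynomial.C (E : ℤ) * MvPolynomial.X 1 - MvPolynomial.C A * MvPolynomial.X 0) ^ e *
      MvPolynomial.C (B ^ ((toPoly Φ).natDegree - e))

/-- Evaluating a renamed one-variable polynomial at `(x, t)` evaluates it at `x`. -/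
theorem aeval_rename_castSucc (Q : MvPolynomial (Fin 1) ℤ) (x t : ℂ) :
    MvPolynomial.aeval ![x, t] (MvPolynomial.rename (Fin.castSucc : Fin 1 → Fin 2) Q) =
      MvPolynomial.aeval ![x] Q := by
  rw [MvPolynomial.aeval_rename]
  have h : (![x, t] ∘ Fin.castSucc : Fin 1 → ℂ) = ![x] := by
    funext i
    fin_cases i
    rfl
  rw [h]

/-- Evaluation of the twisted polynomial `twist Φ A B E`. -/
theorem aeval_twist (A B : ℤ) (E : ℕ) (x t : ℂ) :
    MvPolynomial.aeval ![x, t] (twist Φ A B E) =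
      ∑ e ∈ Finset.range ((toPoly Φ).natDegree + 1),
        MvPolynomial.aeval ![x] ((toPoly Φ).coeff e) * ((((E : ℤ) : ℂ) * t - (A : ℂ) * x) ^ e *
          (B : ℂ) ^ ((toPoly Φ).natDegree - e)) := by
  unfold twist
  rw [map_sum]
  refine Finset.sum_congr rfl fun e _ => ?_
  rw [map_mul, map_mul, map_pow, aeval_rename_castSucc, map_sub, map_mul, map_mul, MvPolynomial.aeval_C,
    MvPolynomial.aeval_C, MvPolynomial.aeval_X, MvPolynomial.aeval_X, MvPolynomial.aeval_C, mul_assoc]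
  simp

/-- `P(x, ρ) = Σ_e P_e(x) ρ^e`. -/
theorem aeval_eq_sum_coeff (P : MvPolynomial (Fin 2) ℤ) (x ρ : ℂ) :
    MvPolynomial.aeval ![x, ρ] P = ∑ e ∈ Finset.range ((toPoly P).natDegree + 1),
      MvPolynomial.aeval ![x] ((toPoly P).coeff e) * ρ ^ e := by
  rw [← eval_map_toPoly, Polynomial.eval_eq_sum_range'
    (lt_of_le_of_lt Polynomial.natDegree_map_le (Nat.lt_succ_self _))]
  refine Finset.sum_congr rfl fun e _ => ?_
  rw [Polynomial.coeff_map]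
  rfl

/-- The twist identity: if `E t − A x = B ρ` then `Φ̃(x, t) = B^{EΦ} Φ(x, ρ)`. -/
theorem aeval_twist_of_eq (A B : ℤ) (E : ℕ) {x t ρ : ℂ} (h : ((E : ℤ) : ℂ) * t - (A : ℂ) * x = (B : ℂ) * ρ) :
    MvPolynomial.aeval ![x, t] (twist Φ A B E) =
      (B : ℂ) ^ (toPoly Φ).natDegree * MvPolynomial.aeval ![x, ρ] Φ := by
  rw [aeval_twist, aeval_eq_sum_coeff, h, Finset.mul_sum]
  refine Finset.sum_congr rfl fun e he => ?_
  have he' : e ≤ (toPoly Φ).natDegree := by rw [Finset.mem_range] at he; omega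
  obtain ⟨j, hj⟩ : ∃ j, (toPoly Φ).natDegree = e + j := ⟨_, (Nat.add_sub_cancel' he').symm⟩
  rw [hj, Nat.add_sub_cancel_left, pow_add, mul_pow]
  ring

/-- The explicit form of `Φ̃(x, ·) ∈ ℂ[X]`: a composition `g ∘ (E X − A x)`. -/
theorem map_toPoly_twist_eq (A B : ℤ) (E : ℕ) (x : ℂ) :
    (toPoly (twist Φ A B E)).map (MvPolynomial.aeval ![x]).toRingHom =
      (∑ e ∈ Finset.range ((toPoly Φ).natDegree + 1),
        Polynomial.C (MvPolynomial.aeval ![x] ((toPoly Φ).coeff e) * (B : ℂ) ^ ((toPoly Φ).natDegree - e)) *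
          Polynomial.X ^ e).comp (Polynomial.C ((E : ℤ) : ℂ) * Polynomial.X + Polynomial.C (-((A : ℂ) * x))) := by
  refine Polynomial.funext fun t => ?_
  rw [eval_map_toPoly, aeval_twist, Polynomial.eval_comp, Polynomial.eval_finsetSum]
  refine Finset.sum_congr rfl fun e _ => ?_
  simp only [Polynomial.eval_mul, Polynomial.eval_C, Polynomial.eval_pow, Polynomial.eval_X,
    Polynomial.eval_add]
  ring

/-- Degree and leading coefficient of `Σ_{e ≤ D} c_e X^e` with `c_D ≠ 0`. -/
theorem natDegree_sum_C_mul_X_pow {c : ℕ → ℂ} {D : ℕ} (hc : c D ≠ 0) :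
    (∑ e ∈ Finset.range (D + 1), Polynomial.C (c e) * Polynomial.X ^ e).natDegree = D ∧
    (∑ e ∈ Finset.range (D + 1), Polynomial.C (c e) * Polynomial.X ^ e).leadingCoeff = c D := by
  set g := ∑ e ∈ Finset.range (D + 1), Polynomial.C (c e) * Polynomial.X ^ e with hg
  have hcoeff : ∀ i, g.coeff i = if i ∈ Finset.range (D + 1) then c i else 0 := by
    intro i
    rw [hg, Polynomial.finsetSum_coeff]
    simp_rw [Polynomial.coeff_C_mul_X_pow]
    exact Finset.sum_ite_eq (Finset.range (D + 1)) i c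
  have hle : g.natDegree ≤ D := by
    refine Polynomial.natDegree_le_iff_coeff_eq_zero.mpr fun N hN => ?_
    rw [hcoeff, if_neg]
    rw [Finset.mem_range]; omega
  have hD : g.coeff D = c D := by rw [hcoeff, if_pos (Finset.self_mem_range_succ D)]
  have hdeg : g.natDegree = D := Polynomial.natDegree_eq_of_le_of_coeff_ne_zero hle (by rw [hD]; exact hc)
  exact ⟨hdeg, by rw [Polynomial.leadingCoeff, hdeg, hD]⟩

variable (hΦ : Φ ≠ 0)
include hΦ

/-- The leading `x₂`-coefficient of `Φ` does not vanish at `π`. -/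
theorem aeval_lcoeff_ne_zero :
    MvPolynomial.aeval ![(Real.pi : ℂ)] ((toPoly Φ).coeff (toPoly Φ).natDegree) ≠ 0 :=
  aeval_pi_ne_zero (Polynomial.leadingCoeff_ne_zero.mpr (toPoly_ne_zero hΦ))

/-- Degree `EΦ` and leading coefficient `Φ_{EΦ}(π)·E^{EΦ}` of `Φ̃(π, ·)`. -/
theorem natDegree_leadingCoeff_ftwist (A B : ℤ) (E : ℕ) (hE : E ≠ 0) :
    ((toPoly (twist Φ A B E)).map (MvPolynomial.aeval ![(Real.pi : ℂ)]).toRingHom).natDegree =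
      (toPoly Φ).natDegree ∧
    ((toPoly (twist Φ A B E)).map (MvPolynomial.aeval ![(Real.pi : ℂ)]).toRingHom).leadingCoeff =
      MvPolynomial.aeval ![(Real.pi : ℂ)] ((toPoly Φ).coeff (toPoly Φ).natDegree) *
        ((E : ℤ) : ℂ) ^ (toPoly Φ).natDegree := by
  rw [map_toPoly_twist_eq]
  have hE' : ((E : ℤ) : ℂ) ≠ 0 := by exact_mod_cast hE
  have hq1 : (Polynomial.C ((E : ℤ) : ℂ) * Polynomial.X + Polynomial.C (-((A : ℂ) * Real.pi))).natDegree = 1 :=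
    Polynomial.natDegree_linear hE'
  have hqlc : (Polynomial.C ((E : ℤ) : ℂ) * Polynomial.X + Polynomial.C (-((A : ℂ) * Real.pi))).leadingCoeff =
      ((E : ℤ) : ℂ) := Polynomial.leadingCoeff_linear hE'
  obtain ⟨hgd, hglc⟩ := natDegree_sum_C_mul_X_pow (D := (toPoly Φ).natDegree)
    (c := fun e => MvPolynomial.aeval ![(Real.pi : ℂ)] ((toPoly Φ).coeff e) *
      (B : ℂ) ^ ((toPoly Φ).natDegree - e))
    (by simpa using aeval_lcoeff_ne_zero Φ hΦ)
  constructor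
  · rw [Polynomial.natDegree_comp, hgd, hq1, mul_one]
  · rw [Polynomial.leadingCoeff_comp (by rw [hq1]; exact one_ne_zero), hglc, hqlc, hgd]
    simp

omit hΦ in
/-- Length of the twisted polynomial. -/
theorem mvlen_twist_le (A B : ℤ) (E : ℕ) :
    mvlen (twist Φ A B E) ≤
      (((toPoly Φ).natDegree + 1 : ℕ) : ℤ) * mvlen Φ * ((E : ℤ) + |A| + |B|) ^ (toPoly Φ).natDegree := by
  unfold twist
  refine (mvlen_sum_le _ _).trans ?_
  set EΦ := (toPoly Φ).natDegree
  set X₀ : ℤ := (E : ℤ) + |A| + |B| with hX₀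
  have hA0 : 0 ≤ |A| := abs_nonneg A
  have hB0 : 0 ≤ |B| := abs_nonneg B
  have hE0 : (0 : ℤ) ≤ (E : ℤ) := by positivity
  have hX0 : 0 ≤ X₀ := by rw [hX₀]; positivity
  have hL : mvlen (MvPolynomial.C (E : ℤ) * MvPolynomial.X (1 : Fin 2) - MvPolynomial.C A * MvPolynomial.X 0) ≤
      (E : ℤ) + |A| := by
    rw [sub_eq_add_neg]
    refine (mvlen_add_le _ _).trans ?_
    rw [mvlen_neg]
    have h1 : ∀ (c : ℤ) (i : Fin 2), mvlen (MvPolynomial.C c * MvPolynomial.X i) ≤ |c| := by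
      intro c i
      calc mvlen (MvPolynomial.C c * MvPolynomial.X i) ≤ |c| * mvlen (MvPolynomial.X i : MvPolynomial (Fin 2) ℤ) :=
            mvlen_C_mul_le _ _
        _ = |c| := by
            rw [show (MvPolynomial.X i : MvPolynomial (Fin 2) ℤ) = MvPolynomial.monomial (Finsupp.single i 1) 1
              from rfl, mvlen_monomial, abs_one, mul_one]
    have h2 := h1 (E : ℤ) 1
    rw [Nat.abs_cast] at h2
    linarith [h1 A 0]
  have hterm : ∀ e ∈ Finset.range (EΦ + 1),
      mvlen (MvPolynomial.rename (Fin.castSucc : Fin 1 → Fin 2) ((toPoly Φ).coeff e) *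
        (MvPolynomial.C (E : ℤ) * MvPolynomial.X 1 - MvPolynomial.C A * MvPolynomial.X 0) ^ e *
        MvPolynomial.C (B ^ (EΦ - e))) ≤ mvlen Φ * X₀ ^ EΦ := by
    intro e he
    have he' : e ≤ EΦ := by rw [Finset.mem_range] at he; omega
    have hce : mvlen (MvPolynomial.rename (Fin.castSucc : Fin 1 → Fin 2) ((toPoly Φ).coeff e)) ≤ mvlen Φ := by
      rw [mvlen_rename _ (Fin.castSucc_injective 1)]
      exact mvlen_toPoly_coeff_le Φ e
    have hLe : mvlen ((MvPolynomial.C (E : ℤ) * MvPolynomial.X (1 : Fin 2) - MvPolynomial.C A * MvPolynomial.X 0) ^ e)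
        ≤ X₀ ^ e :=
      (mvlen_pow_le _ _).trans (pow_le_pow_left₀ (mvlen_nonneg _) (hL.trans (by rw [hX₀]; linarith)) e)
    calc mvlen (MvPolynomial.rename (Fin.castSucc : Fin 1 → Fin 2) ((toPoly Φ).coeff e) *
          (MvPolynomial.C (E : ℤ) * MvPolynomial.X 1 - MvPolynomial.C A * MvPolynomial.X 0) ^ e *
          MvPolynomial.C (B ^ (EΦ - e)))
        ≤ mvlen (MvPolynomial.rename (Fin.castSucc : Fin 1 → Fin 2) ((toPoly Φ).coeff e) *
          (MvPolynomial.C (E : ℤ) * MvPolynomial.X 1 - MvPolynomial.C A * MvPolynomial.X 0) ^ e) *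
            mvlen (MvPolynomial.C (B ^ (EΦ - e)) : MvPolynomial (Fin 2) ℤ) := mvlen_mul_le _ _
      _ ≤ (mvlen Φ * X₀ ^ e) * X₀ ^ (EΦ - e) := by
          refine mul_le_mul ((mvlen_mul_le _ _).trans (mul_le_mul hce hLe (mvlen_nonneg _) (mvlen_nonneg _)))
            ?_ (mvlen_nonneg _) (mul_nonneg (mvlen_nonneg _) (pow_nonneg hX0 _))
          rw [mvlen_C, abs_pow]
          exact pow_le_pow_left₀ hB0 (by rw [hX₀]; linarith) _
      _ = mvlen Φ * X₀ ^ EΦ := by rw [mul_assoc, ← pow_add, Nat.add_sub_cancel' he']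
  calc ∑ e ∈ Finset.range (EΦ + 1), mvlen (MvPolynomial.rename (Fin.castSucc : Fin 1 → Fin 2) ((toPoly Φ).coeff e) *
        (MvPolynomial.C (E : ℤ) * MvPolynomial.X 1 - MvPolynomial.C A * MvPolynomial.X 0) ^ e *
        MvPolynomial.C (B ^ (EΦ - e)))
      ≤ ∑ e ∈ Finset.range (EΦ + 1), mvlen Φ * X₀ ^ EΦ := Finset.sum_le_sum hterm
    _ = ((EΦ + 1 : ℕ) : ℤ) * mvlen Φ * X₀ ^ EΦ := by
        rw [Finset.sum_const, Finset.card_range, nsmul_eq_mul]; ring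

omit hΦ in
/-- Degree of the twisted polynomial. -/
theorem totalDegree_twist_le (A B : ℤ) (E : ℕ) : (twist Φ A B E).totalDegree ≤ Φ.totalDegree := by
  unfold twist
  refine MvPolynomial.totalDegree_finsetSum_le fun e he => ?_
  by_cases hce : (toPoly Φ).coeff e = 0
  · rw [hce, map_zero, zero_mul, zero_mul, MvPolynomial.totalDegree_zero]; exact Nat.zero_le _
  have hL1 : (MvPolynomial.C (E : ℤ) * MvPolynomial.X (1 : Fin 2) - MvPolynomial.C A * MvPolynomial.X 0).totalDegree
      ≤ 1 := by
    refine (MvPolynomial.totalDegree_sub _ _).trans (max_le ?_ ?_) <;>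
      refine (MvPolynomial.totalDegree_mul _ _).trans ?_ <;>
      rw [MvPolynomial.totalDegree_C, MvPolynomial.totalDegree_X, zero_add]
  calc (MvPolynomial.rename (Fin.castSucc : Fin 1 → Fin 2) ((toPoly Φ).coeff e) *
        (MvPolynomial.C (E : ℤ) * MvPolynomial.X 1 - MvPolynomial.C A * MvPolynomial.X 0) ^ e *
        MvPolynomial.C (B ^ ((toPoly Φ).natDegree - e))).totalDegree
      ≤ (MvPolynomial.rename (Fin.castSucc : Fin 1 → Fin 2) ((toPoly Φ).coeff e) *
        (MvPolynomial.C (E : ℤ) * MvPolynomial.X 1 - MvPolynomial.C A * MvPolynomial.X 0) ^ e).totalDegree +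
        (MvPolynomial.C (B ^ ((toPoly Φ).natDegree - e)) : MvPolynomial (Fin 2) ℤ).totalDegree :=
        MvPolynomial.totalDegree_mul _ _
    _ ≤ ((MvPolynomial.rename (Fin.castSucc : Fin 1 → Fin 2) ((toPoly Φ).coeff e)).totalDegree +
        ((MvPolynomial.C (E : ℤ) * MvPolynomial.X (1 : Fin 2) - MvPolynomial.C A * MvPolynomial.X 0) ^ e).totalDegree)
          + 0 := add_le_add (MvPolynomial.totalDegree_mul _ _) (MvPolynomial.totalDegree_C _).le
    _ ≤ (((toPoly Φ).coeff e).totalDegree + e * 1) + 0 :=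
        add_le_add (add_le_add (MvPolynomial.totalDegree_rename_le _ _)
          ((MvPolynomial.totalDegree_pow _ _).trans (Nat.mul_le_mul_left _ hL1))) le_rfl
    _ ≤ Φ.totalDegree := by rw [mul_one, add_zero]; exact totalDegree_toPoly_coeff_add_le Φ e hce

/-- The eliminant `Res_X(toPoly Φ̃_{A,B,E}, toPoly G) ∈ ℤ[x₁]`. -/
noncomputable def resII (G : MvPolynomial (Fin 2) ℤ) (A B : ℤ) (E : ℕ) : MvPolynomial (Fin 1) ℤ :=
  Polynomial.resultant (toPoly (twist Φ A B E)) (toPoly G) (toPoly Φ).natDegree (toPoly G).natDegree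

omit hΦ in
/-- Length and degree of the eliminant. -/
theorem resII_bounds (G : MvPolynomial (Fin 2) ℤ) (A B : ℤ) (E : ℕ) :
    mvlen (resII Φ G A B E) ≤ (Nat.factorial ((toPoly Φ).natDegree + (toPoly G).natDegree) : ℤ) *
      ((((toPoly Φ).natDegree + 1 : ℕ) : ℤ) * mvlen Φ * ((E : ℤ) + |A| + |B|) ^ (toPoly Φ).natDegree + mvlen G) ^
        ((toPoly Φ).natDegree + (toPoly G).natDegree) ∧
    (resII Φ G A B E).totalDegree ≤
      ((toPoly Φ).natDegree + (toPoly G).natDegree) * max Φ.totalDegree G.totalDegree := by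
  unfold resII
  have h0 : (0 : ℤ) ≤ (((toPoly Φ).natDegree + 1 : ℕ) : ℤ) * mvlen Φ * ((E : ℤ) + |A| + |B|) ^ (toPoly Φ).natDegree :=
    mul_nonneg (mul_nonneg (by positivity) (mvlen_nonneg _)) (pow_nonneg (by positivity) _)
  refine resultant_bounds _ _ _ _ (add_nonneg h0 (mvlen_nonneg _)) (fun t => ⟨?_, ?_⟩) (fun t => ⟨?_, ?_⟩)
  · exact ((mvlen_toPoly_coeff_le _ _).trans (mvlen_twist_le Φ A B E)).trans
      (le_add_of_nonneg_right (mvlen_nonneg _))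
  · exact (totalDegree_toPoly_coeff_le _ _).trans ((totalDegree_twist_le Φ A B E).trans (le_max_left _ _))
  · exact (mvlen_toPoly_coeff_le _ _).trans (le_add_of_nonneg_left h0)
  · exact (totalDegree_toPoly_coeff_le _ _).trans (le_max_right _ _)

/-- **Product formula at `π`:** `R(π) = lc(Φ̃(π,·))^K · ∏_{Φ̃(π,r)=0} G(π, r)`. -/
theorem aeval_resII (G : MvPolynomial (Fin 2) ℤ) (A B : ℤ) (E : ℕ) (hE : E ≠ 0) (f : ℂ[X])
    (hf : f = (toPoly (twist Φ A B E)).map (MvPolynomial.aeval ![(Real.pi : ℂ)]).toRingHom) :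
    MvPolynomial.aeval ![(Real.pi : ℂ)] (resII Φ G A B E) =
      f.leadingCoeff ^ (toPoly G).natDegree *
        (f.roots.map fun r => ((toPoly G).map (MvPolynomial.aeval ![(Real.pi : ℂ)]).toRingHom).eval r).prod := by
  obtain ⟨hdeg, -⟩ := natDegree_leadingCoeff_ftwist Φ hΦ A B E hE
  rw [← hf] at hdeg
  unfold resII
  rw [show MvPolynomial.aeval ![(Real.pi : ℂ)] (Polynomial.resultant (toPoly (twist Φ A B E)) (toPoly G)
      (toPoly Φ).natDegree (toPoly G).natDegree) = (MvPolynomial.aeval ![(Real.pi : ℂ)]).toRingHom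
      (Polynomial.resultant (toPoly (twist Φ A B E)) (toPoly G) (toPoly Φ).natDegree (toPoly G).natDegree)
      from rfl, ← Polynomial.resultant_map_map, ← hf, ← hdeg]
  exact Polynomial.resultant_eq_prod_eval f _ _ Polynomial.natDegree_map_le (IsAlgClosed.splits f)

end CaseII

end Bilog
end LatCell
end HyperCell
end Summit.Schanuel.Schanuel.Theorems.RootDecomp1KHyper
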